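import Mathlib
import Summits.AnomalousDissipation.AnomalousDissipation.Theorems.MarginalStabilityChainBurgersLayerKHStubSheetLimitB

/-!
# Toolkit for the vortex-sheet limit (stub `stub_sheetLimit`, line `Sketch`), part C

Crux `MarginalStabilityChain.BurgersLayerKH` (stmt-AnomalousDissipation-3008), line `Sketch`: helper file for the
registered stub `stub_sheetLimit` (the vortex-sheet / long-wave limit of the Rayleigh sheet coefficient;
route and assembly in `…StubSheetLimit.lean`: an exact Wronskian identity for the sheet coefficient plus
a zeroth-order Jost comparison `‖m - m₀‖ = O(α)` from the weighted Volterra theory).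

This file (part C): the decay `m' → 0`, `t m'(t) → 0` at `+∞` (`m' = -e^{2αy}∫_{t>y} e^{-2αt}Vm`,
the limit of `e^{-2αy}m'` being `0` because `e^{-2αy}m → 0`); the sheet identity
`(1 + (2α)⁻¹∫Vm)(λ - iU₊) = (λ + iU₊) - i∫U'm` (two exact derivatives integrated over `ℝ`); and the
summary `slowMode_sheet` for `IsSlowMode α 0 λ ψ`.
-/

set_option linter.dupNamespace false

noncomputable section

open Complex MeasureTheory Filter Topology Set Metric

namespace Summit.AnomalousDissipation.AnomalousDissipation.Theorems.BurgersLayerKH.Sheet.SheetLimit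

/-! ## B2. Decay of `m'` at both ends -/

/-- For `y ≥ 0` and `a > 0`: `1 + y ≤ (1 + 1/a) e^{a y}`. [folklore] -/
theorem one_add_le_mul_exp {a : ℝ} (ha : 0 < a) {y : ℝ} (hy : 0 ≤ y) :
    1 + y ≤ (1 + 1 / a) * Real.exp (a * y) := by
  have h1 : a * y + 1 ≤ Real.exp (a * y) := Real.add_one_le_exp _
  have h2 : 1 ≤ Real.exp (a * y) := Real.one_le_exp (by positivity)
  have h3 : y ≤ Real.exp (a * y) / a := by rw [le_div_iff₀ ha]; nlinarith
  have h4 : (1 + 1 / a) * Real.exp (a * y) = Real.exp (a * y) + Real.exp (a * y) / a := by ring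
  linarith

/-- If `m'' = 2α m' + V m` (`α > 0`), `V` Gaussian and `m` of linear growth, then
`m' → 0` and `t m'(t) → 0` at `+∞` (via `m'(y) = -e^{2αy} ∫_{t>y} e^{-2αt} V m`). [folklore] -/
theorem slow_deriv_decay {α A C₀ : ℝ} (hα : 0 < α) {V m m' : ℝ → ℂ}
    (hm : ∀ y, HasDerivAt m (m' y) y) (hm' : ∀ y, HasDerivAt m' (2 * α * m' y + V y * m y) y)
    (hVc : Continuous V) (hV : ∀ y, ‖V y‖ ≤ A * Real.exp (-(y ^ 2) / 4))
    (hmb : ∀ y, ‖m y‖ ≤ C₀ * (1 + |y|)) :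
    Tendsto m' atTop (𝓝 0) ∧ Tendsto (fun t : ℝ => (t : ℂ) * m' t) atTop (𝓝 0) := by
  have cm : Continuous m := continuous_iff_continuousAt.2 fun y => (hm y).continuousAt
  have cm' : Continuous m' := continuous_iff_continuousAt.2 fun y => (hm' y).continuousAt
  have hA : 0 ≤ A := by
    have := (norm_nonneg _).trans (hV 0); simpa using this
  have hC₀ : 0 ≤ C₀ := by
    have := (norm_nonneg _).trans (hmb 0); simpa using this
  -- the Gaussian bound on `V m`
  have hVm : ∀ y, ‖V y * m y‖ ≤ A * C₀ * ((1 + |y|) ^ 1 * Real.exp (0 * y) * Real.exp (-(y ^ 2) / 4)) := by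
    intro y
    rw [norm_mul, pow_one, zero_mul, Real.exp_zero, mul_one]
    calc ‖V y‖ * ‖m y‖ ≤ (A * Real.exp (-(y ^ 2) / 4)) * (C₀ * (1 + |y|)) :=
          mul_le_mul (hV y) (hmb y) (norm_nonneg _) (by positivity)
      _ = _ := by ring
  have iVm : Integrable fun y => V y * m y :=
    integrable_of_norm_le_polyGauss (hVc.mul cm).aestronglyMeasurable _ _ _ hVm
  -- the conjugated derivative `φ = e^{-2αy} m'` has the integrable derivative `F = e^{-2αy} V m`
  set E2 : ℝ → ℂ := fun y => (Real.exp (-(2 * α) * y) : ℂ) with hE2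
  have hE2d : ∀ y, HasDerivAt E2 ((-(2 * α) : ℝ) * E2 y) y := fun y => by
    simpa [hE2] using hasDerivAt_expWeight (-(2 * α)) y
  have nE2 : ∀ y, ‖E2 y‖ = Real.exp (-(2 * α) * y) := fun y => by
    simp only [hE2, Complex.norm_real, Real.norm_eq_abs, abs_of_pos (Real.exp_pos _)]
  set φ : ℝ → ℂ := fun y => E2 y * m' y with hφ
  set F : ℝ → ℂ := fun y => E2 y * (V y * m y) with hF
  have hφd : ∀ y, HasDerivAt φ (F y) y := by
    intro y
    exact ((hE2d y).mul (hm' y)).congr_deriv (by simp only [hF]; push_cast; ring)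
  have hFn : ∀ y, ‖F y‖ ≤ A * C₀ * ((1 + |y|) ^ 1 * Real.exp (-(2 * α) * y) * Real.exp (-(y ^ 2) / 4)) := by
    intro y
    have h1 : ‖F y‖ = Real.exp (-(2 * α) * y) * ‖V y * m y‖ := by
      simp only [hF, norm_mul, nE2]
    have h2 := hVm y
    rw [zero_mul, Real.exp_zero, mul_one] at h2
    rw [h1]
    calc Real.exp (-(2 * α) * y) * ‖V y * m y‖
        ≤ Real.exp (-(2 * α) * y) * (A * C₀ * ((1 + |y|) ^ 1 * Real.exp (-(y ^ 2) / 4))) := by gcongr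
      _ = _ := by ring
  have cF : Continuous F := by simp only [hF, hE2]; fun_prop
  have iF : Integrable F := integrable_of_norm_le_polyGauss cF.aestronglyMeasurable _ _ _ hFn
  -- `φ` has a limit `L` at `+∞`, and `L = 0` because `e^{-2αy} m → 0`
  have hφlim := tendsto_limUnder_of_hasDerivAt_of_integrableOn_Ioi (a := 0) (fun x _ => hφd x)
    iF.integrableOn
  set L := limUnder atTop φ with hL
  have hfd : ∀ y, HasDerivAt (fun y => E2 y * m y) (φ y + ((-(2 * α) : ℝ) : ℂ) * (E2 y * m y)) y :=
    fun y => ((hE2d y).mul (hm y)).congr_deriv (by simp only [hφ]; ring)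
  have hf0 : Tendsto (fun y => E2 y * m y) atTop (𝓝 0) := by
    refine squeeze_zero_norm' (f := fun y => E2 y * m y)
      (a := fun y => C₀ * (1 + 1 / α) * Real.exp (-α * y)) ?_ ?_
    · filter_upwards [eventually_ge_atTop 0] with y hy
      rw [norm_mul, nE2]
      have h1 := one_add_le_mul_exp hα hy
      have h2 := hmb y
      rw [abs_of_nonneg hy] at h2
      have e : Real.exp (-(2 * α) * y) * Real.exp (α * y) = Real.exp (-α * y) := by
        rw [← Real.exp_add]; congr 1; ring
      calc Real.exp (-(2 * α) * y) * ‖m y‖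
          ≤ Real.exp (-(2 * α) * y) * (C₀ * ((1 + 1 / α) * Real.exp (α * y))) := by
            gcongr; exact h2.trans (by gcongr)
        _ = C₀ * (1 + 1 / α) * Real.exp (-α * y) := by rw [← e]; ring
    · have h1 : Tendsto (fun y : ℝ => -α * y) atTop atBot :=
        tendsto_id.const_mul_atTop_of_neg (by linarith)
      simpa using (Real.tendsto_exp_atBot.comp h1).const_mul (C₀ * (1 + 1 / α))
  have hL0 : L = 0 := by
    refine eq_zero_of_tendsto_of_tendsto_deriv hfd hf0 ?_
    simpa using hφlim.add (hf0.const_mul (((-(2 * α) : ℝ) : ℂ)))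
  rw [hL0] at hφlim
  -- formula `φ(y) = -∫_{t>y} F`
  have hφeq : ∀ y, φ y = -∫ t in Ioi y, F t := by
    intro y
    have := integral_Ioi_of_hasDerivAt_of_tendsto' (a := y) (fun x _ => hφd x) iF.integrableOn hφlim
    rw [this]; ring
  -- the tail bound on `m'`
  have hm'φ : ∀ y, m' y = (Real.exp (2 * α * y) : ℂ) * φ y := by
    intro y
    simp only [hφ, hE2]
    rw [← mul_assoc, ← Complex.ofReal_mul, ← Real.exp_add]
    simp
  have hb1 : ∀ y, ‖m' y‖ ≤ ∫ t in Ioi y, ‖V t * m t‖ := by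
    intro y
    rw [hm'φ y, norm_mul, Complex.norm_real, Real.norm_of_nonneg (Real.exp_pos _).le, hφeq y, norm_neg]
    calc Real.exp (2 * α * y) * ‖∫ t in Ioi y, F t‖ ≤ Real.exp (2 * α * y) * ∫ t in Ioi y, ‖F t‖ := by
          gcongr; exact norm_integral_le_integral_norm _
      _ = ∫ t in Ioi y, Real.exp (2 * α * y) * ‖F t‖ := (integral_const_mul _ _).symm
      _ ≤ ∫ t in Ioi y, ‖V t * m t‖ := by
          refine setIntegral_mono_on ((iF.norm.const_mul _).integrableOn) iVm.norm.integrableOn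
            measurableSet_Ioi fun t ht => ?_
          have h1 : Real.exp (2 * α * y) * ‖F t‖ = Real.exp (2 * α * y + -(2 * α) * t) * ‖V t * m t‖ := by
            simp only [hF, norm_mul, nE2]; rw [Real.exp_add]; ring
          have h2 : Real.exp (2 * α * y + -(2 * α) * t) ≤ 1 :=
            Real.exp_le_one_iff.2 (by nlinarith [le_of_lt (mem_Ioi.1 ht)])
          rw [h1]
          calc _ ≤ 1 * ‖V t * m t‖ := by gcongr
            _ = _ := one_mul _
  refine ⟨squeeze_zero_norm hb1 (ModeZero.tendsto_integral_Ioi_atTop iVm.norm), ?_⟩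
  have iVm1 : Integrable fun t => |t| * ‖V t * m t‖ := by
    refine integrable_of_norm_le_polyGauss (Continuous.aestronglyMeasurable (by fun_prop)) (A * C₀) 2 0
      (fun t => ?_)
    rw [norm_mul, Real.norm_eq_abs, abs_abs, norm_norm]
    have h2 := hVm t
    rw [pow_one] at h2
    have h3 : |t| * ((1 + |t|) * Real.exp (0 * t) * Real.exp (-(t ^ 2) / 4)) ≤
        (1 + |t|) ^ 2 * Real.exp (0 * t) * Real.exp (-(t ^ 2) / 4) := by
      have hp : 0 ≤ (1 + |t|) * Real.exp (0 * t) * Real.exp (-(t ^ 2) / 4) := by positivity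
      have e : (1 + |t|) ^ 2 * Real.exp (0 * t) * Real.exp (-(t ^ 2) / 4) -
          |t| * ((1 + |t|) * Real.exp (0 * t) * Real.exp (-(t ^ 2) / 4)) =
          (1 + |t|) * Real.exp (0 * t) * Real.exp (-(t ^ 2) / 4) := by ring
      linarith
    calc |t| * ‖V t * m t‖ ≤ |t| * (A * C₀ * ((1 + |t|) * Real.exp (0 * t) * Real.exp (-(t ^ 2) / 4))) := by
          gcongr
      _ = A * C₀ * (|t| * ((1 + |t|) * Real.exp (0 * t) * Real.exp (-(t ^ 2) / 4))) := by ring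
      _ ≤ A * C₀ * ((1 + |t|) ^ 2 * Real.exp (0 * t) * Real.exp (-(t ^ 2) / 4)) := by gcongr
  refine squeeze_zero_norm' ?_ (ModeZero.tendsto_integral_Ioi_atTop iVm1)
  filter_upwards [eventually_ge_atTop 0] with t ht
  rw [norm_mul, Complex.norm_real, Real.norm_of_nonneg ht]
  calc t * ‖m' t‖ ≤ t * ∫ s in Ioi t, ‖V s * m s‖ := by gcongr; exact hb1 t
    _ = ∫ s in Ioi t, t * ‖V s * m s‖ := (integral_const_mul _ _).symm
    _ ≤ ∫ s in Ioi t, |s| * ‖V s * m s‖ := by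
        refine setIntegral_mono_on ((iVm.norm.const_mul _).integrableOn) iVm1.integrableOn
          measurableSet_Ioi fun s hs => ?_
        gcongr
        exact le_trans (le_of_lt hs) (le_abs_self s)

/-! ## B3. The sheet identity `(1 + (2α)⁻¹ ∫ V m)(λ - iU₊) = (λ + iU₊) - i ∫ U' m` -/

/-- Wronskian bookkeeping for `m'' = 2αm' + Vm`, `V = iU''/(λ+iU)`: integrating
`(m' - 2αm)' = Vm` and `((λ+iU)(m' - 2αm) - iU'm)' = -2αi U'm` over `ℝ` gives
`(1 + (2α)⁻¹∫Vm)(λ - iU₊) = (λ + iU₊) - i∫U'm`. [folklore] -/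
theorem sheet_identity {α C₀ : ℝ} (hα : 0 < α) {lam : ℂ} (hlam : 0 < lam.re) {m m' : ℝ → ℂ}
    (hm : ∀ y, HasDerivAt m (m' y) y)
    (hm' : ∀ y, HasDerivAt m' (2 * α * m' y + (I * Upp y / (lam + I * U y)) * m y) y)
    (hmb : ∀ y, ‖m y‖ ≤ C₀ * (1 + |y|)) (hlim : Tendsto m atTop (𝓝 1))
    (h0top : Tendsto m' atTop (𝓝 0)) :
    (1 + 1 / (2 * (α : ℂ)) * ∫ t, (I * Upp t / (lam + I * U t)) * m t) * (lam - I * Uinf) =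
      (lam + I * Uinf) - I * ∫ t, (Real.exp (-(t ^ 2) / 2) : ℂ) * m t := by
  have cm : Continuous m := continuous_iff_continuousAt.2 fun y => (hm y).continuousAt
  have hC₀ : 0 ≤ C₀ := by
    have := (norm_nonneg _).trans (hmb 0); simpa using this
  have hα' : (α : ℂ) ≠ 0 := Complex.ofReal_ne_zero.2 hα.ne'
  set V : ℝ → ℂ := fun y => I * Upp y / (lam + I * U y) with hV
  have hVm : ∀ y, ‖V y * m y‖ ≤ 1 / lam.re * C₀ * ((1 + |y|) ^ 1 * Real.exp (0 * y) * Real.exp (-(y ^ 2) / 4)) := by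
    intro y
    rw [norm_mul, pow_one, zero_mul, Real.exp_zero, mul_one]
    calc ‖V y‖ * ‖m y‖ ≤ (1 / lam.re * Real.exp (-(y ^ 2) / 4)) * (C₀ * (1 + |y|)) :=
          mul_le_mul (norm_V_le hlam y) (hmb y) (norm_nonneg _) (by positivity)
      _ = _ := by ring
  have iVm : Integrable fun y => V y * m y :=
    integrable_of_norm_le_polyGauss ((continuous_V hlam).mul cm).aestronglyMeasurable _ _ _ hVm
  -- `G = U' m`
  set G : ℝ → ℂ := fun y => (Real.exp (-(y ^ 2) / 2) : ℂ) * m y with hG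
  have hGn : ∀ y, ‖G y‖ ≤ C₀ * ((1 + |y|) ^ 1 * Real.exp (0 * y) * Real.exp (-(y ^ 2) / 4)) := by
    intro y
    rw [hG]; dsimp only
    rw [norm_mul, Complex.norm_real, Real.norm_of_nonneg (Real.exp_pos _).le, pow_one, zero_mul,
      Real.exp_zero, mul_one]
    have h2 : Real.exp (-(y ^ 2) / 2) ≤ Real.exp (-(y ^ 2) / 4) := Real.exp_le_exp.2 (by nlinarith [sq_nonneg y])
    calc Real.exp (-(y ^ 2) / 2) * ‖m y‖ ≤ Real.exp (-(y ^ 2) / 4) * (C₀ * (1 + |y|)) :=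
          mul_le_mul h2 (hmb y) (norm_nonneg _) (Real.exp_pos _).le
      _ = _ := by ring
  have cG : Continuous G := by simp only [hG]; fun_prop
  have iG : Integrable G := integrable_of_norm_le_polyGauss cG.aestronglyMeasurable _ _ _ hGn
  have hGtop : Tendsto G atTop (𝓝 0) := tendsto_zero_atTop_of_norm_le_polyGauss _ _ _ hGn
  have hGbot : Tendsto G atBot (𝓝 0) := tendsto_zero_atBot_of_norm_le_polyGauss _ _ _ hGn
  -- `f₁ = m' - 2α m`, `f₁' = V m`
  set f₁ : ℝ → ℂ := fun y => m' y - 2 * α * m y with hf₁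
  have hf₁d : ∀ y, HasDerivAt f₁ (V y * m y) y := fun y =>
    ((hm' y).sub ((hm y).const_mul (2 * (α : ℂ)))).congr_deriv (by simp only [hV]; ring)
  have hf₁top : Tendsto f₁ atTop (𝓝 (0 - 2 * α * 1)) := h0top.sub (hlim.const_mul (2 * (α : ℂ)))
  have hf₁bot := tendsto_limUnder_of_hasDerivAt_of_integrableOn_Iic (a := 0) (fun x _ => hf₁d x)
    iVm.integrableOn
  set L₁ := limUnder atBot f₁ with hL₁
  have hI1 : ∫ t, V t * m t = (0 - 2 * α * 1) - L₁ := integral_of_hasDerivAt_of_tendsto hf₁d iVm hf₁bot hf₁top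
  -- `f₂ = (λ + iU) f₁ - i G`, `f₂' = -2αi G`
  set u₁ : ℝ → ℂ := fun y => lam + I * (U y : ℂ) with hu₁
  have hu₁d : ∀ y, HasDerivAt u₁ (I * (Real.exp (-(y ^ 2) / 2) : ℂ)) y := fun y => by
    simpa [hu₁] using ((Strained.hasDerivAt_U y).ofReal_comp.const_mul I).const_add lam
  have hGd : ∀ y, HasDerivAt G ((Upp y : ℂ) * m y + (Real.exp (-(y ^ 2) / 2) : ℂ) * m' y) y := fun y =>
    (hasDerivAt_gauss_half y).ofReal_comp.fun_mul (hm y)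
  set f₂ : ℝ → ℂ := fun y => u₁ y * f₁ y - I * G y with hf₂
  have hf₂d : ∀ y, HasDerivAt f₂ (-(2 * α * I) * G y) y := by
    intro y
    have h := ((hu₁d y).fun_mul (hf₁d y)).fun_sub ((hGd y).const_mul I)
    refine h.congr_deriv ?_
    have hne := add_I_mul_ne_zero hlam (U y)
    simp only [hV, hG, hf₁, hu₁]
    field_simp
    ring
  have hu₁top : Tendsto u₁ atTop (𝓝 (lam + I * Uinf)) :=
    tendsto_const_nhds.add (((continuous_ofReal.tendsto _).comp tendsto_U_atTop).const_mul I)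
  have hu₁bot : Tendsto u₁ atBot (𝓝 (lam + I * ((-Uinf : ℝ) : ℂ))) :=
    tendsto_const_nhds.add (((continuous_ofReal.tendsto _).comp tendsto_U_atBot).const_mul I)
  have hf₂top : Tendsto f₂ atTop (𝓝 ((lam + I * Uinf) * (0 - 2 * α * 1) - I * 0)) :=
    (hu₁top.mul hf₁top).sub (hGtop.const_mul I)
  have hf₂bot : Tendsto f₂ atBot (𝓝 ((lam + I * ((-Uinf : ℝ) : ℂ)) * L₁ - I * 0)) :=
    (hu₁bot.mul hf₁bot).sub (hGbot.const_mul I)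
  have hI2 := integral_of_hasDerivAt_of_tendsto hf₂d (iG.const_mul _) hf₂bot hf₂top
  rw [integral_const_mul] at hI2
  push_cast at hI2
  show (1 + 1 / (2 * (α : ℂ)) * ∫ t, V t * m t) * (lam - I * Uinf) = (lam + I * Uinf) - I * ∫ t, G t
  field_simp
  linear_combination (lam - I * Uinf) * hI1 - hI2

/-! ## B4. The sheet coefficient of a slow mode and the summary -/

/-- `sheetCoeff α ψ = 1 + (2α)⁻¹ ∫ V m`. [folklore] -/
theorem sheetCoeff_eq {α : ℝ} {lam : ℂ} (hlam : 0 < lam.re) {ψ : ℝ → ℂ} (hψ : IsSlowMode α 0 lam ψ) :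
    sheetCoeff α ψ = 1 + 1 / (2 * (α : ℂ)) *
      ∫ t, (I * Upp t / (lam + I * U t)) * ((Real.exp (α * t) : ℂ) * ψ t) := by
  obtain ⟨-, -, h3⟩ := slowMode_ode hlam hψ
  rw [sheetCoeff]
  simp_rw [h3]
  rw [integral_neg]
  ring

/-- **Summary for a slow mode at `h = 0`** (`α > 0`, `re λ > 0`, growth constant `C₀`): `m = e^{αy}ψ` is
continuous, solves the Volterra equation `m = 1 + K_α[V m]`, and its sheet coefficient satisfies
`a (λ - iU₊) = (λ + iU₊) - i ∫ U' m`. [folklore] -/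
theorem slowMode_sheet {α C₀ : ℝ} (hα : 0 < α) {lam : ℂ} (hlam : 0 < lam.re) {ψ : ℝ → ℂ}
    (hψ : IsSlowMode α 0 lam ψ) (hC₀ : ∀ y, ‖(Real.exp (α * y) : ℂ) * ψ y‖ ≤ C₀ * (1 + |y|)) :
    Continuous (fun y => (Real.exp (α * y) : ℂ) * ψ y) ∧
    (∀ y, (Real.exp (α * y) : ℂ) * ψ y = 1 + ∫ t in Ioi y, (volterraKernel α (t - y) : ℂ) *
        (I * Upp t / (lam + I * U t)) * ((Real.exp (α * t) : ℂ) * ψ t)) ∧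
    sheetCoeff α ψ * (lam - I * Uinf) =
      (lam + I * Uinf) - I * ∫ t, (Real.exp (-(t ^ 2) / 2) : ℂ) * ((Real.exp (α * t) : ℂ) * ψ t) := by
  obtain ⟨h1, h2, -⟩ := slowMode_ode hlam hψ
  have hlim : Tendsto (fun y => (Real.exp (α * y) : ℂ) * ψ y) atTop (𝓝 1) := hψ.2.2.2.1
  have hC₀' : 0 ≤ C₀ := by
    have := (norm_nonneg _).trans (hC₀ 0); simpa using this
  have hVb : ∀ y, ‖I * (Upp y : ℂ) / (lam + I * (U y : ℂ))‖ ≤ 1 / lam.re * Real.exp (-(y ^ 2) / 4) :=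
    norm_V_le hlam
  have cm : Continuous fun y => (Real.exp (α * y) : ℂ) * ψ y :=
    continuous_iff_continuousAt.2 fun y => (h1 y).continuousAt
  obtain ⟨dtop, dtop1⟩ := slow_deriv_decay hα h1 h2 (continuous_V hlam) hVb hC₀
  refine ⟨cm, fun y => ?_, ?_⟩
  · have key := volterra_of_ode hα.le (c := 1)
      (F := fun t => (I * Upp t / (lam + I * U t)) * ((Real.exp (α * t) : ℂ) * ψ t)) h1 h2
      ((continuous_V hlam).mul cm) ?_ hlim dtop dtop1 y
    · simpa only [mul_assoc] using key
    · refine integrable_of_norm_le_polyGauss (Continuous.aestronglyMeasurable ?_) (1 / lam.re * C₀) 2 0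
        (fun t => ?_)
      · exact (continuous_const.add continuous_abs).mul ((continuous_V hlam).mul cm).norm
      · rw [norm_mul, Real.norm_of_nonneg (by positivity), norm_norm, norm_mul, zero_mul, Real.exp_zero,
          mul_one]
        calc (1 + |t|) * (‖I * (Upp t : ℂ) / (lam + I * (U t : ℂ))‖ * ‖(Real.exp (α * t) : ℂ) * ψ t‖)
            ≤ (1 + |t|) * ((1 / lam.re * Real.exp (-(t ^ 2) / 4)) * (C₀ * (1 + |t|))) :=
              mul_le_mul_of_nonneg_left (mul_le_mul (hVb t) (hC₀ t) (norm_nonneg _) (by positivity))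
                (by positivity)
          _ = _ := by ring
  · rw [sheetCoeff_eq hlam hψ]
    exact sheet_identity hα hlam h1 h2 hC₀ hlim dtop

/-- Part-C summary (registered sub-goal): the sheet identity of a slow mode at `h = 0`,
`a (λ - iU₊) = (λ + iU₊) - i ∫ U' e^{αt} ψ`. [folklore] -/
theorem sheetLimit_partC : ∀ α C₀ : ℝ, 0 < α → ∀ lam : ℂ, 0 < lam.re → ∀ ψ : ℝ → ℂ, IsSlowMode α 0 lam ψ → (∀ y : ℝ, ‖(Real.exp (α * y) : ℂ) * ψ y‖ ≤ C₀ * (1 + |y|)) → sheetCoeff α ψ * (lam - I * Uinf) = (lam + I * Uinf) - I * ∫ t, (Real.exp (-(t ^ 2) / 2) : ℂ) * ((Real.exp (α * t) : ℂ) * ψ t) :=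
  fun _ _ hα _ hlam _ hψ hC₀ => (slowMode_sheet hα hlam hψ hC₀).2.2

end Summit.AnomalousDissipation.AnomalousDissipation.Theorems.BurgersLayerKH.Sheet.SheetLimit

end
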